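import Summits.SmoothPoincare4.SmoothPoincare4.Theses.CylinderEntropy
import Summits.SmoothPoincare4.SmoothPoincare4.Theorems.CylinderEntropySliceIsolationReduction
import Literature.Geometry.Riemannian.SphericalCylinderSmallScaleDominationProofs
import HarnessLib

/-!
# `CylinderEntropy.SliceIsolation` from the CMS fact and slab confinement alone (line `conformal-kernel-domination`,
# crux stmt-SmoothPoincare4-7632, integration r4)

`Theorems/CylinderEntropySliceIsolationReduction.lean` reduces the crux
`Summit.SmoothPoincare4.SmoothPoincare4.Theses.CylinderEntropy.SliceIsolation` to THREE named inputs: the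
Chodosh–Mantoulidis–Schulze fact, the Cheeger–Yau lower bound for the heat kernel of `S⁴` on the typed zonal series
(`Literature.Geometry.Riemannian.CheegerYauZonalSphereFour`), and slab confinement (registered stub `stub_slabConfinement`).
The Cheeger–Yau fact has since been PROVED in the tree
(`Literature.Geometry.Riemannian.CheegerYauZonalSphereFour_holds`, file
`Literature/Geometry/Riemannian/SphericalCylinderSmallScaleDominationProofs.lean`), so the reduction now needs only TWO inputs:

1. `Literature.Geometry.Riemannian.ChodoshMantoulidisSchulze2025_lowEntropy_sphere_four` (published; Duke 2025, Cor. 1.5 (b),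
   `n = 4`) — classical debt, carried as a hypothesis;
2. slab confinement (hypothesis `hslab`, the registered stub `stub_slabConfinement` verbatim) — a new theorem, NOT asserted here.

This file asserts no route item unconditionally and introduces no definition; it is the registered helper
`helper_sliceIsolationReductionCMS` of the crux item.
-/

noncomputable section

-- the registered namespace `Summit.SmoothPoincare4.SmoothPoincare4.Theorems…` repeats a component
set_option linter.dupNamespace false

open MeasureTheory Set
open scoped Manifold ContDiff ENNReal Topology BigOperators

namespace Summit.SmoothPoincare4.SmoothPoincare4.Theorems.CylinderEntropySliceIsolation

open Literature.Geometry.Riemannian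
open Literature.Geometry.Riemannian.SphericalCylinderEntropy (cylEntropy)

/-- **`SliceIsolation` from the CMS fact and slab confinement** (line `conformal-kernel-domination`, crux
stmt-SmoothPoincare4-7632): the reduction `sliceIsolation_of_slabConfinement` with its Cheeger–Yau hypothesis discharged by the
tree's `CheegerYauZonalSphereFour_holds`. Conditional on exactly two inputs: the published CMS theorem (hypothesis `hCMS`) and
slab confinement (hypothesis `hslab`, the registered stub `stub_slabConfinement` stated verbatim). [folklore] -/
theorem sliceIsolation_of_cms_of_slabConfinement
    (hCMS : ChodoshMantoulidisSchulze2025_lowEntropy_sphere_four)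
    (hslab : ∀ η : ℝ, 0 < η → ∃ ε : ℝ, 0 < ε ∧
      ∀ (M : Type) [TopologicalSpace M] [T2Space M] [SecondCountableTopology M]
        [ChartedSpace (EuclideanSpace ℝ (Fin 4)) M] [IsManifold (𝓡 4) ∞ M] [CompactSpace M]
        [ConnectedSpace M] (ι : M → EuclideanSpace ℝ (Fin 6)), Manifold.IsSmoothEmbedding (𝓡 4) (𝓡 6) ∞ ι →
        (∀ x, ∑ i : Fin 5, ι x (Fin.castSucc i) ^ 2 = 1) →
        (∃ R : ℝ, ∀ a b : EuclideanSpace ℝ (Fin 6), ∑ i : Fin 5, a (Fin.castSucc i) ^ 2 = 1 →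
          ∑ i : Fin 5, b (Fin.castSucc i) ^ 2 = 1 → a 5 ≤ -R → R ≤ b 5 →
          ¬ JoinedIn ({z : EuclideanSpace ℝ (Fin 6) | ∑ i : Fin 5, z (Fin.castSucc i) ^ 2 = 1} \ Set.range ι) a b) →
        cylEntropy (Set.range ι) ≤ ENNReal.ofReal (1 + ε) →
        ∃ t₀ : ℝ, ∀ z ∈ Set.range ι, |z 5 - t₀| ≤ η) :
    Summit.SmoothPoincare4.SmoothPoincare4.Theses.CylinderEntropy.SliceIsolation :=
  sliceIsolation_of_slabConfinement hCMS CheegerYauZonalSphereFour_holds hslab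

/-- Registered helper `helper_sliceIsolationReductionCMS` of crux stmt-SmoothPoincare4-7632 (the reduction above as the registered
one-line `Prop`: CMS fact → slab confinement → `SliceIsolation`; the crux is closed modulo exactly these two). [folklore] -/
theorem helper_sliceIsolationReductionCMS :
    Literature.Geometry.Riemannian.ChodoshMantoulidisSchulze2025_lowEntropy_sphere_four →
    (∀ η : ℝ, 0 < η → ∃ ε : ℝ, 0 < ε ∧
      ∀ (M : Type) [TopologicalSpace M] [T2Space M] [SecondCountableTopology M]
        [ChartedSpace (EuclideanSpace ℝ (Fin 4)) M] [IsManifold (𝓡 4) ∞ M] [CompactSpace M]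
        [ConnectedSpace M] (ι : M → EuclideanSpace ℝ (Fin 6)), Manifold.IsSmoothEmbedding (𝓡 4) (𝓡 6) ∞ ι →
        (∀ x, ∑ i : Fin 5, ι x (Fin.castSucc i) ^ 2 = 1) →
        (∃ R : ℝ, ∀ a b : EuclideanSpace ℝ (Fin 6), ∑ i : Fin 5, a (Fin.castSucc i) ^ 2 = 1 →
          ∑ i : Fin 5, b (Fin.castSucc i) ^ 2 = 1 → a 5 ≤ -R → R ≤ b 5 →
          ¬ JoinedIn ({z : EuclideanSpace ℝ (Fin 6) | ∑ i : Fin 5, z (Fin.castSucc i) ^ 2 = 1} \ Set.range ι) a b) →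
        Literature.Geometry.Riemannian.SphericalCylinderEntropy.cylEntropy (Set.range ι) ≤ ENNReal.ofReal (1 + ε) →
        ∃ t₀ : ℝ, ∀ z ∈ Set.range ι, |z 5 - t₀| ≤ η) →
    Summit.SmoothPoincare4.SmoothPoincare4.Theses.CylinderEntropy.SliceIsolation :=
  sliceIsolation_of_cms_of_slabConfinement

end Summit.SmoothPoincare4.SmoothPoincare4.Theorems.CylinderEntropySliceIsolation

end
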